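import Mathlib
import Literature.LinearAlgebra.Matrix.SylvesterDeterminantIdentity
import Summits.ValiantsHypothesis.ValiantsHypothesis.Theorems.LacunarySymmetroidMatrixDescartesCensusDefs
import Summits.ValiantsHypothesis.ValiantsHypothesis.Theorems.KPlusLogSqLawWeakLiftingTowerGraftSizeMono
import Summits.ValiantsHypothesis.ValiantsHypothesis.Theorems.KPlusLogSqLawWeakLiftingTowerGraftSylvesterCompression
import Summits.ValiantsHypothesis.ValiantsHypothesis.Theorems.KPlusLogSqLawWeakLiftingTowerGraftPivotCongruence

/-!
# Tower graft line — the size-doubling rung S4f IS a budget for the Sylvester minor pencil (T5-𝔅 ⟺ S4f)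

Joint for LINE (B) `Cruxes/WeakLifting/Lines/tower_graft.lean` (rev 9; crux `WeakLifting` = stmt-ValiantsHypothesis-19561, restricted
sub-case `TowerWeakLifting`), S4f / T5 side (desk R2743 (A): «the piece that touches `stub_sizeDoublingPoly` … the honest partial range of
S4f it buys»).  NO registered stub is closed by this file: it proves that the research rung S4f `TowerSizeDoublingPoly` and a T5-shaped
budget for the SYLVESTER MINOR PENCIL are the SAME statement up to the constant, for ALL letter tuples.

Setting: the `(m+1+m)`-pencil `G = Σₗ X^{dₗ} Sₗ` on a tower `d`, split along `e = finSumFinEquiv.trans (finCongr (Nat.add_comm m (m+1)))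
: Fin m ⊕ Fin (m+1) ≃ Fin (m+1+m)` (pivot = the leading `m × m` block), `𝔅` = the `(m+1) × (m+1)` symmetric bordered-minor matrix of
`G.submatrix e e` (val-sym-lift-p2 g18's `…SylvesterCompression`).  «T5-𝔅 with constant C» := for fat tower formats (`2^C·K ≤ m+1`,
`IsTower (m+1) d`) and a budget `PosRootLawOn (m+1) K B d`, every symmetric letter tuple WITH NON-DEGENERATE PIVOT PENCIL has
`Z₊(det 𝔅) ≤ (m+2)^C·B + 2^{C·log₂²(m+1)}` (inlined verbatim in both theorems below; the line's `TowerSizeDoublingPoly` likewise).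

* `sizeDoublingPoly_of_minorPencilLaw` — **T5-𝔅(C) ⇒ S4f(C)** for ALL letter tuples: pivot normalisation by congruence
  (`posRootLawOn_of_nondegenerate_pivots`, `…PivotCongruence`) + Sylvester compression `Z₊(det G) ≤ Z₊(det 𝔅)`
  (`card_posRoots_pencil_le_sylvester`).  No factor, no density argument.
* `roots_borderedMinors_subset`, `card_posRoots_borderedMinors_le` — conversely `Z₊(det 𝔅) ≤ Z₊(det G) + Z₊(det G[ι])`
  unconditionally (Sylvester `det 𝔅 = det G[ι]^m · det G`).
* `minorPencilLaw_of_sizeDoublingPoly` — **S4f(C) ⇒ T5-𝔅(C+1)** (the pivot pencil is a size-`m` class pencil, paid through size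
  monotonicity `sizeMono`, p658112; `minorLaw_arith`).

HONEST RANGE: nothing unconditional about S4f follows — Sylvester is a change of PRESENTATION of the rung (symmetric, size `m+1`, entries
= bordered minors supported on the `(m+1)`-fold sumset, see `…TowerGraftMinorPencil`), exactly as crit-6 READ #26 located; the content of
S4f is whatever law charges `𝔅` by the structure of its letters.  Def-free.  Proves no stub and nothing about `WeakLifting`, Conjecture B /
`KPlusLogSqLaw`, `MatrixDescartes` (18050) or `VP ≠ VNP`.  Seat: prover val-sym-lift-p3 g17, `--supports stmt-ValiantsHypothesis-19561`.
-/

-- `Summit.ValiantsHypothesis.ValiantsHypothesis.…` repeats a component by the D-0017 layout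
-- (single-conjunct summit), which the `dupNamespace` linter flags; the name is mandated.
set_option linter.dupNamespace false

namespace Summit.ValiantsHypothesis.ValiantsHypothesis.Theorems.KPlusLogSqLaw.TowerGraft

open Finset Polynomial Matrix
open scoped BigOperators Polynomial
open Literature.LinearAlgebra.Matrix (borderedMinors)

/-! ### FILE B: the size-doubling rung S4f is EQUIVALENT to a budget for the Sylvester minor pencil (T5-𝔅 shape) -/

section MinorLaw

open Summit.ValiantsHypothesis.ValiantsHypothesis.Theorems.LacunarySymmetroidMatrixDescartes (PosRootLawOn)

/-- roots of the bordered-minor determinant lie among those of `det A` and of the pivot minor (from Sylvester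
`det 𝔅 = det A[ι]^{|μ|-1} · det A`). [folklore] -/
theorem roots_borderedMinors_subset {ι μ : Type*} [Fintype ι] [DecidableEq ι] [Fintype μ] [DecidableEq μ] [Nonempty μ]
    (A : Matrix (ι ⊕ μ) (ι ⊕ μ) ℝ[X]) (hB : (borderedMinors A.toBlocks₁₁ A.toBlocks₁₂ A.toBlocks₂₁ A.toBlocks₂₂).det ≠ 0) :
    (borderedMinors A.toBlocks₁₁ A.toBlocks₁₂ A.toBlocks₂₁ A.toBlocks₂₂).det.roots.toFinset ⊆
      A.det.roots.toFinset ∪ A.toBlocks₁₁.det.roots.toFinset := by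
  have hid := Literature.LinearAlgebra.Matrix.det_borderedMinors_toBlocks A
  intro t ht
  rw [Multiset.mem_toFinset, Polynomial.mem_roots hB] at ht
  rw [hid] at ht hB
  have hA : A.det ≠ 0 := right_ne_zero_of_mul hB
  have hPc : A.toBlocks₁₁.det ^ (Fintype.card μ - 1) ≠ 0 := left_ne_zero_of_mul hB
  rw [Polynomial.IsRoot, Polynomial.eval_mul, Polynomial.eval_pow, mul_eq_zero] at ht
  rw [Finset.mem_union, Multiset.mem_toFinset, Multiset.mem_toFinset, Polynomial.mem_roots hA]
  rcases ht with h1 | h2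
  · right
    obtain ⟨h3, hc⟩ := pow_eq_zero_iff'.mp h1
    have hP : A.toBlocks₁₁.det ≠ 0 := fun h0 => hPc (by rw [h0, zero_pow hc])
    exact (Polynomial.mem_roots hP).mpr h3
  · left
    exact h2

/-- hence, in counting currency and unconditionally: `Z₊(det 𝔅) ≤ Z₊(det A) + Z₊(det A[ι])`. [folklore] -/
theorem card_posRoots_borderedMinors_le {ι μ : Type*} [Fintype ι] [DecidableEq ι] [Fintype μ] [DecidableEq μ] [Nonempty μ]
    (A : Matrix (ι ⊕ μ) (ι ⊕ μ) ℝ[X]) :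
    ((borderedMinors A.toBlocks₁₁ A.toBlocks₁₂ A.toBlocks₂₁ A.toBlocks₂₂).det.roots.toFinset.filter (fun t => 0 < t)).card ≤
      (A.det.roots.toFinset.filter (fun t => 0 < t)).card +
        (A.toBlocks₁₁.det.roots.toFinset.filter (fun t => 0 < t)).card := by
  by_cases hB : (borderedMinors A.toBlocks₁₁ A.toBlocks₁₂ A.toBlocks₂₁ A.toBlocks₂₂).det = 0
  · rw [hB, Polynomial.roots_zero]
    simp
  have hsub := Finset.filter_subset_filter (fun t : ℝ => 0 < t) (roots_borderedMinors_subset A hB)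
  rw [Finset.filter_union] at hsub
  exact (Finset.card_le_card hsub).trans (Finset.card_union_le _ _)

/-- **S4f ⟸ T5-𝔅 (for ALL letter tuples).**  A budget for the Sylvester minor pencil `𝔅` of the `(m+1+m)`-pencil — stated only for
letter tuples whose leading `m × m` pivot pencil is non-degenerate — gives the size-doubling rung `TowerSizeDoublingPoly` of the
line VERBATIM (line defs `IsTower`, `PosRootLawOn` currency), with the SAME constant: the pivot normalisation by congruence
(`posRootLawOn_of_nondegenerate_pivots`) removes the non-degeneracy proviso and Sylvester compression
(`card_posRoots_pencil_le_sylvester`) gives `Z₊(det G) ≤ Z₊(det 𝔅)`. [this work] -/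
theorem sizeDoublingPoly_of_minorPencilLaw
    (hT5 : ∃ C : ℕ, ∀ (m K B : ℕ) (d : Fin K → ℕ), 2 ^ C * K ≤ m + 1 →
      (∀ l l' : Fin K, l < l' → (m + 1) * d l < d l') → PosRootLawOn (m + 1) K B d →
      ∀ (S : Fin K → Matrix (Fin (m + 1 + m)) (Fin (m + 1 + m)) ℝ), (∀ l, (S l).IsSymm) →
        (∑ l, ((X : ℝ[X]) ^ d l) • ((S l).submatrix
            ((finSumFinEquiv.trans (finCongr (Nat.add_comm m (m + 1)))) ∘ Sum.inl)
            ((finSumFinEquiv.trans (finCongr (Nat.add_comm m (m + 1)))) ∘ Sum.inl)).map Polynomial.C).det ≠ 0 →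
        let A := (∑ l, ((X : ℝ[X]) ^ d l) • (S l).map Polynomial.C).submatrix
          (finSumFinEquiv.trans (finCongr (Nat.add_comm m (m + 1))))
          (finSumFinEquiv.trans (finCongr (Nat.add_comm m (m + 1))))
        ((borderedMinors A.toBlocks₁₁ A.toBlocks₁₂ A.toBlocks₂₁ A.toBlocks₂₂).det.roots.toFinset.filter
          (fun t => 0 < t)).card ≤ (m + 2) ^ C * B + 2 ^ (C * Nat.log 2 (m + 1) ^ 2)) :
    ∃ C : ℕ, ∀ (m K B : ℕ) (d : Fin K → ℕ), 2 ^ C * K ≤ m + 1 → (∀ l l' : Fin K, l < l' → (m + 1) * d l < d l') →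
      PosRootLawOn (m + 1) K B d → PosRootLawOn (m + 1 + m) K ((m + 2) ^ C * B + 2 ^ (C * Nat.log 2 (m + 1) ^ 2)) d := by
  obtain ⟨C, hC⟩ := hT5
  refine ⟨C, fun m K B d hK hd hB => ?_⟩
  apply posRootLawOn_of_nondegenerate_pivots
  intro S' hS' hpiv
  have hp := hpiv (Fin m) ((finSumFinEquiv.trans (finCongr (Nat.add_comm m (m + 1)))) ∘ Sum.inl)
    ((finSumFinEquiv.trans (finCongr (Nat.add_comm m (m + 1)))).injective.comp Sum.inl_injective)
  have h1 := (card_posRoots_pencil_le_sylvester (finSumFinEquiv.trans (finCongr (Nat.add_comm m (m + 1)))) d S' hS' hp).2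
  exact h1.trans (hC m K B d hK hd hB S' hS' hp)

/-- the arithmetic of the converse: `(m+2)^C B + 2^{C L²} + B ≤ (m+2)^{C+1} B + 2^{(C+1) L²}`. [folklore] -/
theorem minorLaw_arith (m C B L : ℕ) :
    (m + 2) ^ C * B + 2 ^ (C * L ^ 2) + B ≤ (m + 2) ^ (C + 1) * B + 2 ^ ((C + 1) * L ^ 2) := by
  have h1 : (m + 2) ^ C * B + B ≤ (m + 2) ^ (C + 1) * B := by
    have h2 : (m + 2) ^ C + 1 ≤ (m + 2) ^ (C + 1) := by
      rw [pow_succ]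
      have h3 : 1 ≤ (m + 2) ^ C := Nat.one_le_pow _ _ (by omega)
      nlinarith
    nlinarith
  have h4 : 2 ^ (C * L ^ 2) ≤ 2 ^ ((C + 1) * L ^ 2) := Nat.pow_le_pow_right two_pos (by nlinarith)
  omega

/-- **T5-𝔅 ⟸ S4f (constant `C + 1`).**  Conversely the size-doubling rung bounds the minor pencil: by Sylvester
`det 𝔅 = det G[ι]^m · det G`, so `Z₊(det 𝔅) ≤ Z₊(det G) + Z₊(det G[ι])`, the first term paid by S4f at size `m + 1 + m`, the
second by the hypothesis budget at size `m + 1` through size monotonicity (`sizeMono`, p658112).  With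
`sizeDoublingPoly_of_minorPencilLaw`: S4f and the minor-pencil budget are the SAME statement up to `C ↦ C + 1` — Sylvester is a
change of presentation of the size-doubling rung (symmetric, size `m + 1`, entries = bordered minors), not yet a reduction. [this work] -/
theorem minorPencilLaw_of_sizeDoublingPoly
    (hSD : ∃ C : ℕ, ∀ (m K B : ℕ) (d : Fin K → ℕ), 2 ^ C * K ≤ m + 1 → (∀ l l' : Fin K, l < l' → (m + 1) * d l < d l') →
      PosRootLawOn (m + 1) K B d → PosRootLawOn (m + 1 + m) K ((m + 2) ^ C * B + 2 ^ (C * Nat.log 2 (m + 1) ^ 2)) d) :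
    ∃ C : ℕ, ∀ (m K B : ℕ) (d : Fin K → ℕ), 2 ^ C * K ≤ m + 1 →
      (∀ l l' : Fin K, l < l' → (m + 1) * d l < d l') → PosRootLawOn (m + 1) K B d →
      ∀ (S : Fin K → Matrix (Fin (m + 1 + m)) (Fin (m + 1 + m)) ℝ), (∀ l, (S l).IsSymm) →
        (∑ l, ((X : ℝ[X]) ^ d l) • ((S l).submatrix
            ((finSumFinEquiv.trans (finCongr (Nat.add_comm m (m + 1)))) ∘ Sum.inl)
            ((finSumFinEquiv.trans (finCongr (Nat.add_comm m (m + 1)))) ∘ Sum.inl)).map Polynomial.C).det ≠ 0 →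
        let A := (∑ l, ((X : ℝ[X]) ^ d l) • (S l).map Polynomial.C).submatrix
          (finSumFinEquiv.trans (finCongr (Nat.add_comm m (m + 1))))
          (finSumFinEquiv.trans (finCongr (Nat.add_comm m (m + 1))))
        ((borderedMinors A.toBlocks₁₁ A.toBlocks₁₂ A.toBlocks₂₁ A.toBlocks₂₂).det.roots.toFinset.filter
          (fun t => 0 < t)).card ≤ (m + 2) ^ C * B + 2 ^ (C * Nat.log 2 (m + 1) ^ 2) := by
  obtain ⟨C, hC⟩ := hSD
  refine ⟨C + 1, fun m K B d hK hd hB S hS _ => ?_⟩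
  intro A
  have hK' : 2 ^ C * K ≤ m + 1 :=
    le_trans (Nat.mul_le_mul_right K (Nat.pow_le_pow_right two_pos (Nat.le_succ C))) hK
  -- the big pencil is paid by S4f
  have hG := hC m K B d hK' hd hB S hS
  -- the pivot pencil (size m, letters `S l` restricted) is paid by the budget at size m + 1 through size monotonicity
  have hM := sizeMono m (m + 1) K B d (Nat.le_succ m) hB
    (fun l => (S l).submatrix ((finSumFinEquiv.trans (finCongr (Nat.add_comm m (m + 1)))) ∘ Sum.inl)
      ((finSumFinEquiv.trans (finCongr (Nat.add_comm m (m + 1)))) ∘ Sum.inl))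
    (fun l => (hS l).submatrix _)
  have hA : A.det = (∑ l, ((X : ℝ[X]) ^ d l) • (S l).map Polynomial.C).det := Matrix.det_submatrix_equiv_self _ _
  have hP : A.toBlocks₁₁ = ∑ l, ((X : ℝ[X]) ^ d l) • ((S l).submatrix
      ((finSumFinEquiv.trans (finCongr (Nat.add_comm m (m + 1)))) ∘ Sum.inl)
      ((finSumFinEquiv.trans (finCongr (Nat.add_comm m (m + 1)))) ∘ Sum.inl)).map Polynomial.C := by
    rw [← submatrix_pencil]
    ext a b
    rfl
  refine ((card_posRoots_borderedMinors_le A).trans ?_).trans (minorLaw_arith m C B (Nat.log 2 (m + 1)))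
  rw [hA, hP]
  exact Nat.add_le_add hG hM

end MinorLaw

end Summit.ValiantsHypothesis.ValiantsHypothesis.Theorems.KPlusLogSqLaw.TowerGraft
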